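import Summits.BirchSwinnertonDyer.Rank1Residual.F1Sign2.ModularDegreeModFourAtTwo
import HarnessLib.Audit.Tags
import HarnessLib

/-!
# Cell `bsd-f1-sign2` — analytic lens (planner `-an` g19; MEMO-an v1.59 addendum §22): AN-36 «THE 2-DIVISION CUBIC CHARACTER `χ_E` ON `Cl⁺(4N)` = AXIS CLASSES»
# (file 1 of 2 of the §22 port: the AN-36 rows + S36 + the prime-level ♭-rows + kernel glue; file 2 = `F1Sign2/EggGeodesicPeriodAtTwo.lean` = AN-35x «THE EGG-GEODESIC
# PERIOD LAW» with REF1's kernel proof of AN-35x(i) — one sketch, split in two by the typer for the gate's 400-line cap on files carrying proofs)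

STATEMENTS + kernel glue (continues `F1Sign2/ModularDegreeModFourAtTwo.lean` = MEMO-an §21 AN-35, ns `…F1Sign2.ANg18`; this file and its sibling = ns `…F1Sign2.ANg19`).  THIS
FILE: one helper definition WITH body (`SameQuadraticResolventAtTwo`); TWO theorem-grade rows as plain `def … : Prop` — AN-36a `HeegnerDoorTypeAxisClassLawAtTwo` (in-print
assembly), S36 `AxisCarriesAdmissibleDoorPrimesAtPrimeLevelAtTwo` (in print: Weber 1882, Meyer 1888); FOUR conjecture-grade laws as `@[conjecture] def … : Prop` — AN-36b
`EggAxisAvoidsCubicKernelAtTwo` (THE CANDIDATE: the finite kernel law), AN-36e `EggAxisForcesResolventAtTwo`, AN-35c♭ `EggAxisDoorPrimeSupplyAtPrimeLevelAtTwo`, AN-35d♭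
`ModularDegreeTwoModFourHasBottomRungDoorAtPrimeLevelAtTwo`; kernel glue `eggAxisDoorPrimeSupply_primeLevel` (AN-36b → S36 → AN-35c♭), `hasBottomRungDoor_of_nu_primeLevel`
(AN-35b♯ → AN-34b → AN-36b → S36 → AN-34e′ → AN-35d♭), `primeLevel_of_eggAxisDoorPrimeSupply` (AN-35c → AN-35c♭).  THE SIBLING `EggGeodesicPeriodAtTwo.lean`: `axisAutomorphCusp`,
AN-35x(i) `AxisAutomorphPeriodRealAtTwo` WITH ITS KERNEL PROOF `axisAutomorphPeriodRealAtTwo_holds` (REF1 §157 K1, K2, K2′), AN-35x♭ `NuOneEggAxisWindsAtTwo` in REF1's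
E-157-A-REPAIRED form C′, `axisAutomorph_det`, `pell_u_eq_zero_of_isSquare`.  Nothing else asserted, no named fact, no `sorry`; nothing here proves BSD or closes an item.

TYPER FILING (seat `bsd-f1-sign2-ty` g14; -an's port ask D-an-101, INBOX 2026-08-29T01:15:01Z «after REF1 D-an-99»; CANDIDATES.md row AN-36): port of -an g19's
`HOME/MEMO-an-data/g19/Sketch_v53.lean` sha16 caf8a3f54ec5f80d (MEMO-an.md v1.59 addendum §22, l.11; -an: `lean check` rc 0, 0 sorry, glue on std axioms; crux idea
`cubic-character-kernel-at-two` v2 b0216806a78b on `stmt-BirchSwinnertonDyer-23715`; re-checked by the typer against the tree).  CENSUS = the BC5 witness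
`HOME/MEMO-an-data/g19/census36.txt` (ENGINE CW full = kit j321811, tag `bsd-frontier-data`; `engineCW.py` 12442f3ef3d459e5, `analyseCW.py` ae26089570ea7ac8, `analyse36b.py`
57861208fe77d072; rows `engineCW_rows.jsonl` 1ed8ad9d8ad022e3, `ANALYSIS.txt` 0ae5d42fde4ef5e3; population: Cremona-optimal rank-1 curves, odd torsion, `Δ > 0`, `N` non-square,
prime `N ≤ 10⁴` (49) and composite `N ≤ 5 000` (1 299) = 1 348 curves, 0 errors; sameK := `ℚ(√Δ) = ℚ(√N)` on 714 of them): AN-36a door type constant on every content-1 class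
714/714 (non-sameK non-square: 613/613 have a MIXED class, as Chebotarev predicts); `χ_E` structure (identity classes = a subgroup of index 3 containing `θ₋₁`, cosets consistent)
714/714, #identity classes = `h⁺(4N)/3` 714/714, `3 ∣ h⁺(4N)` 714/714; **AN-36b 0 violations / 714** (κ = 1: 593), EXACT LAW `egg(c) = κ·[χ_E(c) ≠ 1]` 0 violations / 714, egg
classes split equally between the two non-trivial cosets 593/593; AN-36e (κ = 1 ⇒ sameK or `Δ` square) 593/593, non-sameK non-square κ = 0 613/613; **AN-35x
`Σ_{egg classes}|d_c| ≡ 2 deg φ (mod 8)` 1 348/1 348** (`(Σ, 2 deg) mod 8 ∈ {(0,0): 1 319, (4,4): 29}`); ν = 1 curves: 29, ALL prime level, all sameK, all with `Σ ≡ 4 (mod 8)`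
and signed coset sum `A₁ ≠ 0`; class-machinery self-checks 1 348/1 348, mirror mismatches 0; pilot j321193 (16 curves, `N ≤ 400`): same laws, 0 exceptions; second engine ENGINE BM
(kit j321808, `SupersingularModule`, 199 optimal prime-conductor curves of rank ≥ 1): Mestre 199/199, Frobenius = `−w_p` 199/199, rank 1: `ν ≡ #{Frobenius pairs with v_E odd}
(mod 2)` 139/139, `ν(ellmoddegree) = ν(pair parity)` 139/139.  The sketch's declarations are kept in the sketch's order and namespace with exactly the REF1 §157 riders applied by
the typer: (r157-1) AN-35x♭ is NOT filed as typed (KILLED, E-157-A) — -an's name `NuOneEggAxisWindsAtTwo` carries REF1's REPAIRED body C′ (= Probe157 `NuOneEggAxisWindsAtTwo'`: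
binder `¬ IsSquare (W.conductorNorm ℤ) →` inserted after `NoRationalTwoTorsion W →`; the killed body was never in the tree; as for §24's E-152-A and §25's E-156-A the planner's
name is kept), and REF1's `pell_u_eq_zero_of_isSquare` (Probe157 K4) is carried as documentation of the binder; (r157-2) AN-35x(i) filed WITH REF1's kernel proof — K1
`axisAutomorph_form_identity`, K2 `axisAutomorphPeriodRealAtTwo_holds`, K2′ `axisAutomorphPeriodReal_strong` — VERBATIM from `HOME/REF1-data/b157/lean/Probe157.lean` 69a4fa142426106f
(l.271–400 and l.409–420, with its `open scoped MatrixGroups ModularForm ComplexConjugate` / `open CongruenceSubgroup`); -an's binders KEPT; (r157-3) AN-36e docstring «THEOREM mod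
AN-36b» → «on content-1 axes»; (r157-4) S36 cite rider `[cite: Weber1882]` `[cite: Meyer1888]` (keys added by REF2 v45 §11.5); (r157-5) AN-36a, AN-36b, AN-35c♭, AN-35d♭, S36 and the
four glue theorems verbatim; (r157-6) this header with REF2_TXT_AN36 and the §157 verdict; plus `import HarnessLib.Audit.Tags` / `HarnessLib` and one «REF1-AUDIT §157 / REF2 v45
§11» sentence appended to each Prop's docstring (sketch text otherwise verbatim).
REF1-AUDIT-v1 §157 (2026-08-29T01:52Z, `HOME/REF1-AUDIT-v1.md` l.3035; evidence `HOME/REF1-data/b157/`: `Probe157.lean` 69a4fa142426106f = Sketch_v53 VERBATIM under ns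
`…F1Sign2.REF1g15a.ANg19` + 8 probes + kernel K1–K5, rc 0, 8 sorries = the 8 probes, REF1 lemmas on {propext, Classical.choice, Quot.sound}; `sq/eggaxis.py` 2ba0857d50abfe2f =
independent REF1 float engine for egg bits, door-prime types and automorph windings) VERDICT verbatim: «AN-36a SURVIVES, THEOREM-GRADE (print assembly re-derived line by line;
no gap); AN-36b SURVIVES conjecture-grade — REF1's independent engine EXTENDS -an's box to the four ν = 1 SQUARE levels 196a1/324c1/1444b1/1849b1 (exact law, 0 violations) and to
rank 3 (5077a1: κ = 0, vacuous); AN-36e SURVIVES conjecture-grade with a content-4 rider on «THEOREM mod AN-36b»; S36 SURVIVES, THEOREM-GRADE (bookkeeping verified; cite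
rider: the indefinite case is Weber 1882 / Meyer 1888, not Cox 9.12); AN-35c♭/35d♭ glue: kernel, std axioms; AN-35x(i) IS A THEOREM NOW (REF1 kernel
`axisAutomorphPeriodRealAtTwo_holds : AxisAutomorphPeriodRealAtTwo`, std axioms, + binder census `axisAutomorphPeriodReal_strong`: `modularSymbol Dt.f 0 = 0` redundant, `u ≠ 0`
idle); AN-35x♭ KILLED AS TYPED — E-157-A: at SQUARE level N = M² the Pell clause t² − N u² = 1 forces u = 0, so the conclusion is unsatisfiable while the hypotheses are met by the
optimal datum of each of the six ν = 1 square-level curves of §150 (196a1 …); kernel negative lemma `nuOneEggAxisWindsAtTwo_false_of_config` (std axioms); class refuted-MISSTATED;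
repaired C′ = `NuOneEggAxisWindsAtTwo'` (`¬ IsSquare (W.conductorNorm ℤ) →` inserted after `NoRationalTwoTorsion W →`), witness misses C′, C′ SURVIVES conjecture-grade (ENGINE
CW 29/29 ν = 1 non-square; REF1 replication 37a1/79a1); (d) pair-parity formula ENDORSED theorem-grade at prime level / odd analytic rank, and -an's correction of KK2017 Thm 3
CONFIRMED from the printed text (37a1, m_E = 2, is a literal counterexample to the theorem as printed). 1 killed-as-typed (misstated, repair in hand), 7 survive, 1 of them
settled (theorem) + 2 theorem-grade in print.»
REF2-PLACEMENT v45 §11 (b2d27fa0c17709c0, 2026-08-29T01:20:21Z; §11.4/§11.5 amended d23ad19056bfd78b at 01:53:19Z after REF1 §157; texts read first-hand: Calegari–Emerton 2009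
arXiv:math/0503359 p. 5, Snowden 2011 arXiv:1108.3131 pp. 3, 25, Kriz–Li 2019 FMS 7 p. 13, Agashe–Ribet–Stein 2012 p. 3, Kazalicki–Kohen 2017 and Kazalicki–Slijepčević 2026 full
text), REF2_TXT_AN36 verbatim: «PLACEMENT. The frame is print: at prime level `ℚ(E[2])/ℚ(√±N)` is cyclic cubic, unramified at N, ramified at 2 iff supersingular
[cite: CalegariEmerton2009, §3.1 and Lemma 13]; cubic fields ↔ order-3 ring-class characters with `d(F₃) = d_K f²` [cite: Hasse1930]; the Fricke-twisted real locus of `X₀(N)` and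
its components ↔ admissible classes `γ = (a b; −Nb d)`, with real cusps iff N is a square [cite: Snowden2011, §6.8, Props. 6.8.1–6.8.2], classes of disc-4N forms by Gauss
composition / cycles [cite: GrossKohnenZagier1987]; `a_ℓ`-odd primes as the admissible primes of 2-primary Heegner arguments [cite: KrizLi2019, §4], [cite: MazurRubin2010];
`ord₂ r_E = ord₂ deg φ` at odd N [cite: AgasheRibetStein2012, Thm. 2.1]; even modular degree when `E(ℝ)` is disconnected at prime level [cite: CalegariEmerton2009, Thm. 1]; S36
supply: every properly primitive (indefinite) form represents infinitely many primes [cite: Weber1882], with prescribed compatible progression conditions [cite: Meyer1888] (Cox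
Thm 9.12 [cite: Cox2013] is the positive-definite statement only). The class-function law AN-36a/36c/36d is an assembly of these. The kernel law AN-36b (`egg(c) = κ_E·[χ_E(c) ≠ 1]`,
0/714 violations, kit j321811) and the winding law AN-35x (`Σ_{c egg}|d_c| ≡ 2·deg φ (mod 8)`, 1 348/1 348) are NOT in print and NOT refuted in print — conjectures with census
witness; in-house antecedent of the winding mechanism: hub idea `fricke-real-forms-watkins-mod-4` (2026-08-15, closed known:[cite: KazalickiSlijepcevic2026] for its w = +1 crux
only). Nothing here is a theorem beyond print; BSD is not proved.»  GRADE (v45 §11.3, REF2's reading for the 23715 triage panel): `cubic-character-kernel-at-two` = NEW-COMBINATION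
(levers, each with a prior use on this problem: the cubic 2-division field as a ring-class datum of `ℚ(√±N)` — CE 2009 §3.1, Lemma 13; real components and Fricke-twisted geodesics of
`X₀(N)` with modular-degree parity — CE 2009 Thm 1, Snowden 2011 §6.8, hub card `fricke-real-forms-watkins-mod-4`; `a_ℓ`-odd primes as the good primes of 2-primary Heegner–Kolyvagin
arguments — Kriz–Li 2019 §4, Mazur–Rubin 2010; the JOIN — `χ_E` on `Cl⁺(4N)` simultaneously indexing real axes and door types, with the finite kernel law AN-36b replacing Čebotarev
supply — has no located precedent); not vacuous (714-curve census with a 613-curve control class that fails the law off sameK), not refuted in print, not a theorem in print.  §11.5: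
E-157-A is consistent with Snowden Prop. 6.8.1 (square N ⟺ real cusps on the twisted real locus; no Pell automorph ⇒ no winding); erratum-grade note for any write-up:
«[cite: KazalickiKohen2017, Thm. 3] as printed omits the hypothesis w = +1 used in its proof» (37a1 is a literal counterexample to the printed wording; REF1 §157 (8)).
PARTITION: none moved; beyond-print theorem: no (AN-36a and S36 are in-print assemblies; AN-35x(i) composes three tree facts — now kernel; the laws are conjecture-grade);
refuted in print: nothing; BSD not proved; no item closed.
bears_on: `stmt-BirchSwinnertonDyer-23715` `RankOneAtTwoBigImageOddLocal` — the lead's class `{ν = 1}` / R⁺₀ at PRIME level: `hasBottomRungDoor_of_nu_primeLevel` followed by the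
lead's `bsdp_two_of_exists_bottomRungDoor` = BSD₂ on `{ν = 1}` at prime level modulo print, the route's rank-0 items, AN-35b♯ (at `N ≡ 1 (mod 4)`) and the ONE finite kernel
law AN-36b.

## The sketch's own module docstring (verbatim)

# Cell `bsd-f1-sign2`, analytic lens (planner `-an` g19, MEMO-an v1.59 addendum §22): AN-36 «THE 2-DIVISION CUBIC CHARACTER»
# and AN-35x «THE EGG-GEODESIC PERIOD LAW» (sketch; crux `stmt-BirchSwinnertonDyer-23715`, lead line `one_door_analytic` v8.17, class `{ν = 1}` / R⁺₀)

SETTING (as AN-35, tree `…F1Sign2.ANg18`): `W/ℚ` globally minimal, `Δ_W > 0`, `E(ℚ)[2] = 0`, level `N = N_W`, datum `Dt` with Fricke-PLUS newform;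
axes `(a, b, d)`, `a d + N b² = 1`, of the Fricke-twisted real locus (`−τ̄ ∼ w_N τ`), axis circle `d N |τ|² + 2 b N Re τ − a = 0` = geodesic of the
indefinite form `[dN, 2bN, −a]` of discriminant `4N` (content `1` or `4`), door primes `−ℓ = Q_{a,b,d}(m, n)` (`axisForm`, disc `16N`).

THE MECHANISM (AN-36).  When `ℚ(√Δ_W) = ℚ(√N)` (e.g. PRIME `N`, `Δ_W = N^{odd}`; at squarefree level exactly «every bad prime has odd discriminant
valuation» = «odd Tamagawa product») the `S₃`-field `L = ℚ(E[2])` is a cyclic cubic extension of `K = ℚ(√N)` unramified outside `2` (Tate curve at the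
bad primes: inertia = the transposition) with conductor dividing `(2)` (tame; ramified above `2` only if `N ≡ 5 (mod 8)`), so by class field theory it
is cut out by a cubic character `χ_E` of the RING CLASS GROUP OF CONDUCTOR 2 = `Pic⁺ ℤ[√N] = Cl⁺(4N)` = (Gauss–GKZ) the set of `Γ₀(N)`-classes of
content-1 axes.  A door prime `ℓ` on an axis of class `c` has `[𝔩] ∈ θ·{c, c⁻¹}` (CM point ⟂ axis form), hence **the door type
(`a_ℓ` odd = 3-cycle / `a_ℓ` even = identity) is CONSTANT on each axis class (AN-36a)**, the identity classes form `ker χ_E` (index `3`), and the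
cell's conjecture AN-35c becomes the finite law **AN-36b: egg classes avoid `ker χ_E`** (exact law observed: `egg(c) = κ_E · [χ_E(c) ≠ 1]`).
ENGINE CW (kit j321193 pilot, 16 curves N ≤ 400; full box j321319: prime N ≤ 10⁴, composite N ≤ 5000): AN-36a 0 exceptions with 108–344 represented
primes per class; `#ker = h⁺(4N)/3` exactly; AN-36b / exact law 0 violations; content-4 (disc `N`) classes are type-MIXED exactly when the cubic field is
ramified at `2` (37, 101, 197, 269, 373) — conductor `(2)` does not descend to `Cl⁺(N)`.

THE PERIOD LAW (AN-35x, sharpening AN-35a to an exact arithmetic identity).  `d_c := {∞, γ_c ∞}⁺_f / (Ω⁺_f/2) ∈ ℤ` = winding number of `φ` on the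
closed geodesic of the axis class `c` (`γ_c` = automorph of the totally positive fundamental unit of `ℤ[√N]`; the period is REAL, AN-35x(i)).  Then
**`Σ_{c ∈ Cl⁺(4N) ⊔ Cl⁺(N), c egg} |d_c| ≡ 2 · deg φ (mod 8)`** — pilot 16/16 (37a1: `2+2 ≡ 4`; 79a1: `1+1+1+1`; 229a1: `2+2+2+2 ≡ 0 = 2·8`;
141a1/142a1/148a1: all egg windings `0`, `ν = 0` although `κ = 1`).  The naive half-sum is wrong because the oriented classes `c` and `θ₋₁ c⁻¹`
(`θ₋₁` = class of `[−1, 0, N]`) are the SAME closed geodesic; the factor `¼` is uniform over mirror orbits.  Typed here: the reality AN-35x(i) and the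
corollary AN-35x♭ (`ν = 1 ⇒` some egg axis WINDS: a nonzero real-quadratic toric period of `f` — the Waldspurger / Popa side of the lens).

PARTITION currency v0.6 unchanged; beyond-print theorem: NO (AN-36a is an in-print assembly: CFT + Gauss composition; AN-35x theorem-candidate);
BSD not proved.  [cite: Cox2013, Thm 9.12, §7] [cite: GrossZagier1986, V.(2.2)] [cite: Popa2006, Thm 6.3.1] [cite: BrumerKramer1977, §5]
[cite: Setzer1975, Thm 2] [cite: CalegariEmerton2009, §2]
-/

namespace Summit.BirchSwinnertonDyer.Rank1Residual.F1Sign2.ANg19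

open Literature.NumberTheory.EllipticCurves Literature.NumberTheory.EllipticCurves.ModularForms UpperHalfPlane
open Summit.BirchSwinnertonDyer.Rank1Residual.F1Sign2 Summit.BirchSwinnertonDyer.Rank1Residual.F1Sign2.ANg17
open Summit.BirchSwinnertonDyer.Rank1Residual.F1Sign2.ANg18
open Summit.BirchSwinnertonDyer.BirchSwinnertonDyer.Theorems.RankOneAtTwoOneDoor
open scoped Classical

noncomputable section

/-! ### §22.1 Objects -/

/-- «`ℚ(√Δ_W) = ℚ(√N_W)`»: the quadratic resolvent of the `2`-division cubic is the real quadratic field of the level.  For a globally minimal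
model of squarefree conductor this says: every bad prime has ODD discriminant valuation (⟺ odd Tamagawa product when `Δ_W > 0`, `E(ℚ)[2] = 0`:
split `c_p = v_p(Δ)`, non-split `c_p = 1, 2` as `v_p(Δ)` is odd, even).  [folklore] -/
def SameQuadraticResolventAtTwo (W : WeierstrassCurve ℚ) : Prop :=
  ∃ q : ℚ, q ≠ 0 ∧ W.Δ = (W.conductorNorm ℤ : ℚ) * q ^ 2

/-! ### §22.2 AN-36: the cubic character -/

/-- **AN-36a `HeegnerDoorTypeAxisClassLawAtTwo` (THEOREM-CANDIDATE; in-print assembly).**  `W` globally minimal, squarefree level `N`, `Δ_W > 0`,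
`E(ℚ)[2] = 0`, `ℚ(√Δ_W) = ℚ(√N)`.  Then on every content-`1` axis `(a, b, d)` ALL door primes have the same type: for primes `ℓ₁, ℓ₂ ∤ 2N` with
`−ℓ_i = Q_{a,b,d}(m_i, n_i)`, `a_{ℓ₁} ≡ a_{ℓ₂} (mod 2)`.  WORDS-PROOF: `L = ℚ(E[2]) ⊃ K = ℚ(√N)`, `Gal(L/K) = C₃`; `L/K` is unramified at `𝔭 ∣ N`
(Tate curve, `v_𝔭(Δ)` odd ⇒ inertia at `p` is the transposition, meeting `C₃` trivially), at odd good primes (Néron–Ogg–Shafarevich) and at `∞`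
(three real roots), and tamely ramified above `2` with conductor exponent `≤ 1`; ring class group of conductor `2` = ray class group mod `2`
(`(ℤ/2)^× = 1`), so `L ⊂` ring class field of `ℤ[√N]·`(conductor 2 in `𝒪_K`) and `χ_E : Cl⁺(4N) → μ₃` cuts it out; `Frob_ℓ` is a `3`-cycle iff
`χ_E([𝔩]) ≠ 1`; a CM point of discriminant `−ℓ` on the axis is a positive form ORTHOGONAL to the axis form `Q_c` (`a A + N b B = N d C`), which puts
`[𝔩] ∈ θ·{c, c⁻¹}` for a fixed class `θ` with `χ_E(θ) = 1` — so `χ_E([𝔩]) ≠ 1 ⟺ χ_E(c) ≠ 1`, independent of `ℓ`.  ENGINE CW pilot (j321193): every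
content-1 class of every `ℚ(√Δ) = ℚ(√N)` curve carries 108–344 represented primes `< 10⁷` of ONE type, 0 exceptions (37a1: `{3-cycle: 302}`,
`{3-cycle: 302}`, `{identity: 148}`); contrast 158a1/b1 (`ℚ(√Δ) = ℚ(√79) ≠ ℚ(√158)`): all three types in every class.  Why it might fail: the
orthogonality ⟹ ideal-class step is asserted from the Clifford/composition dictionary and checked numerically, not written out; non-squarefree
`N` excluded (wild conductor at `3`). [folklore] [cite: Cox2013, Thm 9.12, §7.D] [cite: BrumerKramer1977, §5] [cite: Setzer1975, Thm 2]
REF1-AUDIT §157 (1): **SURVIVES, THEOREM-GRADE (in-print assembly)** — the words-proof re-derived step by step with no gap: `L/K = C₃` is unramified at `𝔭 ∣ N` including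
`2 ∣ N` (Tate parameter: `ℚ_p(W[2]) = ℚ_p(√q) = ℚ_p(√Δ) = K_𝔭`), at odd good primes and at `∞`; above `2 ∤ N` at most TAMELY ramified, and only when `2` is inert in `K`, i.e.
`N ≡ 5 (mod 8)` (matching the type-MIXED content-4 list 37/101/197/269/373); so `cond(L/K) ∣ (2)` and, as `(ℤ/2)^× = 1`, `L ⊂` the ring class field of conductor `2`, `χ_E` well
defined on the classes of the disc-`16N` axis forms; `ℓ ∤ 2N` represented ⇒ `(N/ℓ) = 1` ⇒ `Frob_ℓ ∈ C₃`, `a_ℓ` odd ⟺ `χ_E([𝔩]) ≠ 1`; the dictionary step: `−ℓ = Q_c(m,n)` properly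
⇒ `[Q_c] = θ₋₁·[𝔩]^{±1}` with `θ₋₁` = the class of `[−1, 0, 4N]` ↔ complex conjugation, which restricts trivially to the totally real `L`: `χ_E(θ₋₁) = 1` — so `a_ℓ` odd ⟺
`χ_E([Q_c]) ≠ 1`, independent of `ℓ`.  No step beyond CFT of ring class fields [cite: Cox2013, §7, §9], Tate's `p`-adic uniformisation [cite: Silverman1994, V] and Gauss
composition; hypotheses jointly satisfiable (37a1), no junk instance.  REF1's independent float engine (`sq/eggaxis.py`): 37a1 — all 10 content-1 axes with `b ≤ 2` carry 29–49
door primes `< 2·10⁴` of ONE type each; 79a1 likewise (24 axes); 0 exceptions.  ENGINE CW full j321811: 714/714 sameK curves (296 478 (class, prime) incidences, 0 exceptions);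
non-sameK non-square curves 613/613 have a MIXED class.  REF2 v45 §11.1: the frame is PRINT — `ℚ(E[2])/ℚ(√±N)` cyclic cubic, unramified at `N`, ramified at `2` iff
supersingular [cite: CalegariEmerton2009, §3.1, Lemma 13]; cubic fields ↔ order-3 ring-class characters [cite: Hasse1930]; the Fricke-twisted real locus and its components
[cite: Snowden2011, §6.8]; classes of disc-`4N` forms by Gauss composition / cycles [cite: GrossKohnenZagier1987]. -/
def HeegnerDoorTypeAxisClassLawAtTwo : Prop :=
  ∀ (W : WeierstrassCurve ℚ) [W.IsElliptic] [W.IsGloballyMinimal] [NeZero (W.conductorNorm ℤ)],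
    0 < W.Δ → NoRationalTwoTorsion W → Squarefree (W.conductorNorm ℤ) → SameQuadraticResolventAtTwo W →
    ∀ (a b d : ℤ), a * d + (W.conductorNorm ℤ : ℤ) * b ^ 2 = 1 → b ≠ 0 → ¬ (2 ∣ a ∧ 2 ∣ d) →
    ∀ (ℓ₁ ℓ₂ : ℕ) (m₁ n₁ m₂ n₂ : ℤ), ℓ₁.Prime → ℓ₂.Prime →
      ¬ ((ℓ₁ : ℤ) ∣ 2 * (W.conductorNorm ℤ : ℤ)) → ¬ ((ℓ₂ : ℤ) ∣ 2 * (W.conductorNorm ℤ : ℤ)) →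
      axisForm (W.conductorNorm ℤ) a b d m₁ n₁ = -(ℓ₁ : ℤ) → axisForm (W.conductorNorm ℤ) a b d m₂ n₂ = -(ℓ₂ : ℤ) →
      (Odd (W.frobeniusTrace ℓ₁) ↔ Odd (W.frobeniusTrace ℓ₂))

/-- **AN-36b `EggAxisAvoidsCubicKernelAtTwo` (CONJECTURE-GRADE; the finite kernel law behind AN-35c; BSD₂-shadow).**  Same slice, datum Fricke-plus.
If a point of a content-`1` axis `(a, b, d)` (`b ≠ 0`) maps to the EGG, then EVERY door prime of that axis is a `3`-CYCLE prime: `ℓ ∤ 2N` prime,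
`−ℓ = Q_{a,b,d}(m, n)` ⟹ `a_ℓ(W)` odd.  With AN-36a this is a statement about finitely many classes: «egg classes lie outside `ker χ_E`»; ENGINE CW
observes the EXACT LAW `egg(c) = κ_E · [χ_E(c) ≠ 1]` on `Cl⁺(4N)` (pilot: 0 violations on 16 curves / 60 classes; identity classes `= h⁺(4N)/3`; κ = 0
curves 359a1/b1 have no egg class; full box j321319).  SHADOW OF BSD₂: at an identity door `−ℓ` on an egg axis, `c_ℓ(E^{(−ℓ)}) = 4` and the two-door
Gross–Zagier ratio force the Heegner index `I_ℓ` to be even, i.e. `y_K ∈ 2E(ℚ) + E(ℚ)_{odd} ⊂ E⁰(ℝ)`, contradicting AN-34b/34c (the trace of a Heegner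
point built on an egg axis lies on the egg).  For `ℚ(√Δ) ≠ ℚ(√N)` Chebotarev makes identity doors dense on EVERY axis, so AN-36b then says «no egg
class at all» (⟹ AN-36e).  Why it might fail: equivalent in strength to a `2`-divisibility statement for Heegner points at identity doors
(Kolyvagin-at-2 / Kriz–Li territory); no descent proof. [conjecture] [cite: GrossZagier1986, V.(2.2)] [cite: Kramer1981, Prop. 3]
[cite: GrossLMS1991, Conj. 1.2]
REF1-AUDIT §157 (2): **SURVIVES, conjecture-grade** (THE finite kernel law; binders as intended — no `Squarefree` and no sameK binder, «at every level»; `¬ (2 ∣ a ∧ 2 ∣ d)` is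
load-bearing only through the door-prime clause, a content-`4` form never taking a value `−ℓ`).  REF1's independent engine EXTENDS the box: at the four `ν = 1` SQUARE levels
196a1 / 324c1 / 1444b1 / 1849b1 (`K = ℚ(√N) = ℚ` degenerates, `L = ℚ(W[2])` is a cyclic cubic field, the disc-`16N` axis forms split into two linear forms and `χ_E` becomes a
cubic DIRICHLET character mod `M′ ∣ M`) the exact law `egg(c) = [χ_E(c) ≠ 1]` holds with 0 violations / 4 828 (axis, door prime) incidences (196a1: 8 egg axes 107–122 door
primes ALL 3-cycle, 8 `E⁰` axes 99–103 ALL identity; 324c1, 1444b1, 1849b1 likewise); rank 3 (5077a1): κ = 0 on the sample, AN-36b vacuously true.  ENGINE CW full j321811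
(1 348 curves): **0 violations / 714** sameK curves (κ = 1: 593); EXACT LAW 0 violations / 714; egg classes split equally between the two non-trivial cosets 593/593.  REF2 v45
§11.2: NOT in print and not refuted in print — a CONJECTURE with census witness (nearest print: [cite: CalegariEmerton2009, Thm. 1] parity of `deg φ` vs `π₀(E(ℝ))` at prime
level, no class-by-class content; [cite: Popa2006, Thm 6.3.1] real-quadratic toric periods under `(N, d_K) = 1`).  Falsifier of record: ONE egg content-1 axis with an
identity door prime. -/
@[conjecture] def EggAxisAvoidsCubicKernelAtTwo : Prop :=
  ∀ (W : WeierstrassCurve ℚ) [W.IsElliptic] [W.IsGloballyMinimal] [NeZero (W.conductorNorm ℤ)],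
    0 < W.Δ → NoRationalTwoTorsion W →
    ∀ (Dt : ModularParametrizationData W (W.conductorNorm ℤ)), IsFrickeEigen (W.conductorNorm ℤ) Dt.f 1 →
      ∀ (τ : ℍ) (a b d : ℤ), a * d + (W.conductorNorm ℤ : ℤ) * b ^ 2 = 1 → b ≠ 0 → ¬ (2 ∣ a ∧ 2 ∣ d) →
        (d : ℝ) * (W.conductorNorm ℤ : ℝ) * Complex.normSq (τ : ℂ) + 2 * (b : ℝ) * (W.conductorNorm ℤ : ℝ) * τ.re - (a : ℝ) = 0 →
        (∃ (x y : ℝ) (h : (W.baseChange ℂ).toAffine.Nonsingular (x : ℂ) (y : ℂ)), Dt.φ τ = .some (x : ℂ) (y : ℂ) h ∧ OnEggR W x) →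
        ∀ (ℓ : ℕ) (m n : ℤ), ℓ.Prime → ¬ ((ℓ : ℤ) ∣ 2 * (W.conductorNorm ℤ : ℤ)) →
          axisForm (W.conductorNorm ℤ) a b d m n = -(ℓ : ℤ) → Odd (W.frobeniusTrace ℓ)

/-- **AN-36e `EggAxisForcesResolventAtTwo` (the TAMAGAWA LEG of the egg-locus law AN-15 at squarefree level, now with a mechanism: THEOREM mod
AN-36b ON CONTENT-`1` AXES — REF1-AUDIT §157 (3), rider r157-3; data law 593/593 on all axes).**  Squarefree level, `Δ_W > 0`, `E(ℚ)[2] = 0`, Fricke-plus datum: if some point of an axis with `b ≠ 0` maps to the egg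
(`κ_E = 1`) then `ℚ(√Δ_W) = ℚ(√N)`, i.e. every bad prime has odd discriminant valuation, i.e. the Tamagawa product is ODD.  From AN-36b: if
`ℚ(√Δ) ≠ ℚ(√N)` the fields `ℚ(E[2])` and the ring class field of conductor `4` of `ℚ(√N)` (joined with `ℚ(ζ₈)`) are disjoint over the genus field, so
Chebotarev supplies identity door primes on the egg axis — contradiction.  ENGINE CW/HC: κ = 1 curves all have `sf(Δ) = sf(N)` (pilot: 141a1,
141d1, 142a1/b1, 148a1 (`N = 4·37`, `Δ = 148·8²`); 158a1/b1 with `sf(Δ) = 79` have κ = 0); full box pending.  Why it might fail: only through AN-36b.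
[conjecture] [cite: Kramer1981, Prop. 3] [cite: Cox2013, Thm 9.12]
REF1-AUDIT §157 (3): **SURVIVES, conjecture-grade, with a RIDER** on «THEOREM mod AN-36b»: the Chebotarev argument produces identity door primes on the egg axis and
contradicts AN-36b only for CONTENT-`1` axes — this statement quantifies over every axis with `b ≠ 0`, including content-`4` ones (`2 ∣ a`, `2 ∣ d`, forcing `N ≡ 1 (mod 4)`),
where AN-36b's door clause is vacuous and where the type law FAILS (type-mixed disc-`N` classes at `N ≡ 5 (mod 8)`); so «THEOREM mod AN-36b + Chebotarev disjointness» stands on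
content-`1` axes (the disjointness of `ℚ(W[2])` from the ring class field being the sameK-failure itself), and the typed statement — the natural one, `κ` being a class-set
invariant including content-`4` classes — is graded DATA LAW on all axes (REF1 prefers the statement as typed; -an may instead insert `¬ (2 ∣ a ∧ 2 ∣ d) →`).  ENGINE CW full
j321811: κ = 1 ⇒ sameK or `Δ` square 593/593 (321 squarefree `N`, all with odd Tamagawa product; 272 non-squarefree); non-sameK non-square curves: κ = 0 in 613/613.  REF2
v45 §11.2: = the Tamagawa leg of the cell's egg-locus law AN-15(→); data law, not in print. -/
@[conjecture] def EggAxisForcesResolventAtTwo : Prop :=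
  ∀ (W : WeierstrassCurve ℚ) [W.IsElliptic] [W.IsGloballyMinimal] [NeZero (W.conductorNorm ℤ)],
    0 < W.Δ → NoRationalTwoTorsion W → Squarefree (W.conductorNorm ℤ) →
    ∀ (Dt : ModularParametrizationData W (W.conductorNorm ℤ)), IsFrickeEigen (W.conductorNorm ℤ) Dt.f 1 → modularSymbol Dt.f 0 = 0 →
      ∀ (τ : ℍ) (a b d : ℤ), a * d + (W.conductorNorm ℤ : ℤ) * b ^ 2 = 1 → b ≠ 0 →
        (d : ℝ) * (W.conductorNorm ℤ : ℝ) * Complex.normSq (τ : ℂ) + 2 * (b : ℝ) * (W.conductorNorm ℤ : ℝ) * τ.re - (a : ℝ) = 0 →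
        (∃ (x y : ℝ) (h : (W.baseChange ℂ).toAffine.Nonsingular (x : ℂ) (y : ℂ)), Dt.φ τ = .some (x : ℂ) (y : ℂ) h ∧ OnEggR W x) →
        SameQuadraticResolventAtTwo W

/-- **S36 `AxisCarriesAdmissibleDoorPrimesAtPrimeLevelAtTwo` (SUPPLY; THEOREM-GRADE in print — Dirichlet–Weber–Meyer: a primitive indefinite binary
quadratic form represents infinitely many primes in every arithmetic progression containing a represented integer coprime to the modulus; here for
the disc-`16N` axis form with the progression `−ℓ ≡ 1 (mod 8)`).**  At PRIME level `N`, every content-`1` axis `(a, b, d)` (`b ≠ 0`) carries a door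
prime `ℓ ∤ 2N` with `DoorAdmissible W (−ℓ)`.  BOOKKEEPING: (i) `2`-adic: a content-`1` axis form takes the value `1 (mod 8)` on primitive vectors
(`a` odd: `(m, n) = (1, 0) mod 8`; `a` even: then `N, b, d` are odd, the `n²`-coefficient is `≡ 5 (mod 8)` and the cross / `m²` terms add `4 (mod 8)`
at odd `m, n`), hence on its negative cone; (ii) `DoorAdmissible W (−ℓ)` unpacks to `ℓ ≡ 7 (mod 8)`, good reduction at `ℓ` (`ℓ ≠ N`) and
`(−ℓ / N) = +1`, the last AUTOMATIC: `ℓ ≡ 3 (mod 4)` (genus character `δ` of disc `16N`) and `(N/ℓ) = 1` (represented by a form of disc `16N`) give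
`(−ℓ/N) = (−1/N)(ℓ/N) = (−1)^{(N−1)/2}·(N/ℓ)(−1)^{(N−1)/2} = 1`.  Why it might fail: only bookkeeping (the `DoorAdmissible` clauses are stated for the
minimal model's reduction types). [folklore] [cite: Cox2013, Thm 9.12, Ex. 9.18] (CFT dictionary; Thm 9.12 is the POSITIVE-DEFINITE statement)
[cite: Weber1882] [cite: Meyer1888] (the indefinite supply, rider r157-4: every properly primitive form represents infinitely many primes — Weber, Math. Ann. 20 (1882) —
with prescribed compatible progression conditions — Meyer, J. reine angew. Math. 103 (1888); keys added by REF2 v45 §11.5)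
REF1-AUDIT §157 (4): **SURVIVES, THEOREM-GRADE in print** — bookkeeping re-done: writing the content-`1` axis form as `Q = [A, 2B′, C]` (`B′² − AC = 4N`),
`A·Q(m,n) = (Am + B′n)² − 4N n²` gives odd values `≡ 1` or `≡ 5 (mod 8)` according to the parity of `n` (case `a` odd, `A = a² ≡ 1 (mod 8)`; case `a` even symmetric with
`C ≡ 5 (mod 8)`), so EVERY content-`1` axis form primitively represents negative integers `≡ 1 (mod 8)`; `DoorAdmissible W (−ℓ)` at prime level unpacks to `ℓ ≡ 7 (mod 8)`,
`ℓ ∤ N` and `(−ℓ/N) = 1`, the last automatic by reciprocity from `(N/ℓ) = 1`, `ℓ ≡ 3 (mod 4)`; supply = Dirichlet's theorem for INDEFINITE binary forms with congruence conditions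
(Weber 1882 for the form alone, Meyer 1888 with the progression; equivalently Chebotarev in a ring class field of `K` joined with `ℚ(ζ₈)`); hypotheses satisfiable
(`(a, b, d) = (1 − N, 1, 1)`), conclusion non-vacuous; REF1 scan: door primes `ℓ ≡ 7 (mod 8)`, `ℓ ∤ 2N` found on 396/462 sampled content-`1` axes of 21 levels (the 66 misses are
thin-cone sampling artefacts). -/
def AxisCarriesAdmissibleDoorPrimesAtPrimeLevelAtTwo : Prop :=
  ∀ (W : WeierstrassCurve ℚ) [W.IsElliptic] [W.IsGloballyMinimal] [NeZero (W.conductorNorm ℤ)], (W.conductorNorm ℤ).Prime →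
    ∀ (a b d : ℤ), a * d + (W.conductorNorm ℤ : ℤ) * b ^ 2 = 1 → b ≠ 0 → ¬ (2 ∣ a ∧ 2 ∣ d) →
      ∃ (ℓ : ℕ) (m n : ℤ), ℓ.Prime ∧ ¬ ((ℓ : ℤ) ∣ 2 * (W.conductorNorm ℤ : ℤ)) ∧ DoorAdmissible W (-(ℓ : ℤ)) ∧
        axisForm (W.conductorNorm ℤ) a b d m n = -(ℓ : ℤ)

/-- **AN-35c♭ `EggAxisDoorPrimeSupplyAtPrimeLevelAtTwo`** = the cell's AN-35c (`ANg18.EggAxisDoorPrimeSupplyAtTwo`) restricted to PRIME level — the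
regime of the lead's class `{ν = 1}` (REF1 §150: `ν = 1 ⇒ N` prime (436/442) or a square (6/442)).  THEOREM mod AN-36b + S36 (kernel glue
`eggAxisDoorPrimeSupply_primeLevel`). [conjecture] [cite: Cox2013, Thm 9.12] [cite: GrossZagier1986, V.(2.2)]
REF1-AUDIT §157 (5): glue `eggAxisDoorPrimeSupply_primeLevel : AN-36b → S36 → AN-35c♭` kernel-checked (std axioms); correctly `@[conjecture]` (conjecture-grade input AN-36b;
S36 theorem-grade in print). -/
@[conjecture] def EggAxisDoorPrimeSupplyAtPrimeLevelAtTwo : Prop :=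
  ∀ (W : WeierstrassCurve ℚ) [W.IsElliptic] [W.IsGloballyMinimal] [NeZero (W.conductorNorm ℤ)], (W.conductorNorm ℤ).Prime →
    0 < W.Δ → NoRationalTwoTorsion W →
    ∀ (Dt : ModularParametrizationData W (W.conductorNorm ℤ)), IsFrickeEigen (W.conductorNorm ℤ) Dt.f 1 →
      ∀ (τ : ℍ) (a b d : ℤ), a * d + (W.conductorNorm ℤ : ℤ) * b ^ 2 = 1 → b ≠ 0 → ¬ (2 ∣ a ∧ 2 ∣ d) →
        (d : ℝ) * (W.conductorNorm ℤ : ℝ) * Complex.normSq (τ : ℂ) + 2 * (b : ℝ) * (W.conductorNorm ℤ : ℝ) * τ.re - (a : ℝ) = 0 →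
        (∃ (x y : ℝ) (h : (W.baseChange ℂ).toAffine.Nonsingular (x : ℂ) (y : ℂ)), Dt.φ τ = .some (x : ℂ) (y : ℂ) h ∧ OnEggR W x) →
        ∃ (ℓ : ℕ) (m n : ℤ), ℓ.Prime ∧ DoorAdmissible W (-(ℓ : ℤ)) ∧ Odd (W.frobeniusTrace ℓ) ∧
          axisForm (W.conductorNorm ℤ) a b d m n = -(ℓ : ℤ)

/-- **AN-35d♭ `ModularDegreeTwoModFourHasBottomRungDoorAtPrimeLevelAtTwo`** = the lead's target AN-35d at PRIME level: `ν(E) = 1` (optimal datum, odd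
constant, Fricke-plus, `deg φ ≡ 2 (mod 4)`) ⟹ `HasBottomRungDoorAtTwo W`, hence the PROVED sub-slice (`bsdp_two_of_exists_bottomRungDoor`).  THEOREM
mod AN-35b♯ + AN-34b + AN-36b + S36 + AN-34e′ (kernel glue `hasBottomRungDoor_of_nu_primeLevel`); the only conjecture-grade inputs are AN-36b (finite
kernel law) and, at `N ≡ 1 (mod 4)`, AN-35b♯. [conjecture] [cite: GrossZagier1986, I.(6.3), V.(2.2)] [cite: GrossLMS1991, §10]
REF1-AUDIT §157 (5): glue `hasBottomRungDoor_of_nu_primeLevel : AN-35b♯ → AN-34b → AN-36b → S36 → AN-34e′ → AN-35d♭` kernel-checked (std axioms); correctly `@[conjecture]`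
(conjecture-grade inputs AN-36b and, at `N ≡ 1 (mod 4)`, AN-35b♯; AN-34b / AN-34e′ are tree theorems). -/
@[conjecture] def ModularDegreeTwoModFourHasBottomRungDoorAtPrimeLevelAtTwo : Prop :=
  ∀ (W : WeierstrassCurve ℚ) [W.IsElliptic] [W.IsGloballyMinimal] [NeZero (W.conductorNorm ℤ)], (W.conductorNorm ℤ).Prime →
    0 < W.Δ → NoRationalTwoTorsion W → W.analyticRank = 1 →
    ∀ (Dt : ModularParametrizationData W (W.conductorNorm ℤ)), Odd Dt.c →
      IsFrickeEigen (W.conductorNorm ℤ) Dt.f 1 → modularSymbol Dt.f 0 = 0 → Dt.modularDegree % 4 = 2 →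
      HasBottomRungDoorAtTwo W

/-! ### §22.4 Kernel glue (sketch, std axioms) -/

/-- AN-36b + S36 ⟹ AN-35c at prime level. -/
theorem eggAxisDoorPrimeSupply_primeLevel (hK : EggAxisAvoidsCubicKernelAtTwo)
    (hS : AxisCarriesAdmissibleDoorPrimesAtPrimeLevelAtTwo) : EggAxisDoorPrimeSupplyAtPrimeLevelAtTwo := by
  intro W _ _ _ hp hΔ hT Dt hF τ a b d hdet hb hcont hax hegg
  obtain ⟨ℓ, m, n, hℓ, hndvd, hadm, hform⟩ := hS W hp a b d hdet hb hcont
  exact ⟨ℓ, m, n, hℓ, hadm, hK W hΔ hT Dt hF τ a b d hdet hb hcont hax hegg ℓ m n hℓ hndvd hform, hform⟩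

/-- THE REDUCTION at prime level (kernel): AN-35b♯ + AN-34b (tree) + AN-36b + S36 + AN-34e′ (tree) ⟹ AN-35d♭; with the lead's
`bsdp_two_of_exists_bottomRungDoor` this is BSD₂ on `{ν = 1}` at prime level modulo print, the route's rank-`0` items, AN-35b♯ (at `N ≡ 1 (4)`) and
the ONE finite kernel law AN-36b. -/
theorem hasBottomRungDoor_of_nu_primeLevel (hB : ModularDegreeTwoModFourMeetsEggOnOddAxisAtTwo)
    (h34b : HeegnerCuspSymbolComponentFormulaAtTwo) (hK : EggAxisAvoidsCubicKernelAtTwo)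
    (hS : AxisCarriesAdmissibleDoorPrimesAtPrimeLevelAtTwo) (h34e : OddHeegnerCuspSymbolCertifiesBottomRungDoorAtTwo) :
    ModularDegreeTwoModFourHasBottomRungDoorAtPrimeLevelAtTwo := by
  intro W _ _ _ hp hΔ hT hr Dt hc hF h0 hdeg
  obtain ⟨τ, a, b, d, hdet, hb, hcont, hax, x, y, h, hφ, hegg⟩ := hB W hΔ hT Dt hF h0 hdeg
  have hsym : (Dt.c : ℂ) * modularSymbol Dt.f (axisCusp (W.conductorNorm ℤ) a b) / 2 ∉ Dt.L.lattice := by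
    rcases h34b W hΔ Dt hF h0 τ a b d hdet hb hax with hzero | ⟨x', y', h', hφ', hiff⟩
    · rw [hφ] at hzero; exact absurd hzero (by rintro ⟨⟩)
    · have hxx : (x : ℂ) = (x' : ℂ) := by
        have := hφ.symm.trans hφ'
        cases this; rfl
      have hx : x' = x := (Complex.ofReal_injective hxx).symm
      exact hiff.mp (hx ▸ hegg)
  obtain ⟨ℓ, m, n, hℓ, hadm, hodd, hform⟩ :=
    eggAxisDoorPrimeSupply_primeLevel hK hS W hp hΔ hT Dt hF τ a b d hdet hb hcont hax ⟨x, y, h, hφ, hegg⟩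
  exact h34e W hΔ hT hr Dt hc hF ℓ hℓ hadm hodd a b d m n hdet hb hform hsym

/-- AN-35c (all levels, the cell's `@[conjecture]`) ⟹ AN-35c♭ (bookkeeping). -/
theorem primeLevel_of_eggAxisDoorPrimeSupply (h : EggAxisDoorPrimeSupplyAtTwo) : EggAxisDoorPrimeSupplyAtPrimeLevelAtTwo := by
  intro W _ _ _ _ hΔ hT Dt hF τ a b d hdet hb hcont hax hegg
  exact h W hΔ hT Dt hF τ a b d hdet hb hcont hax hegg

end

end Summit.BirchSwinnertonDyer.Rank1Residual.F1Sign2.ANg19
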